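import Summits.BirchSwinnertonDyer.BirchSwinnertonDyer.Theses.SylvesterTwoHeegnerIndex
import Summits.BirchSwinnertonDyer.BirchSwinnertonDyer.Theorems.SylvesterTwoHeegnerIndexFirstLayerSplit
import Summits.BirchSwinnertonDyer.BirchSwinnertonDyer.Theorems.SylvesterTwoHeegnerIndexCoupledUpperBoundReductionSeven
import Summits.BirchSwinnertonDyer.BirchSwinnertonDyer.Theorems.SylvesterTwoHeegnerIndexCoupledDescentFirstLayerOfLayerL1
import Summits.BirchSwinnertonDyer.BirchSwinnertonDyer.Theorems.SylvesterTwoHeegnerIndexCMFlipLayerL1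
import Summits.BirchSwinnertonDyer.BirchSwinnertonDyer.Theorems.SylvesterTwoHeegnerIndexCMHalfInvolutionFixingBottomOfLevel

/-! # Skeleton VARIANT N for crux `UpperOffV0HSYPlus` (stmt-BirchSwinnertonDyer-19804) —
«VARIANT M WITH THE PRINT INPUTS NAMED» (planner bsd-cm-plan g30, 2026-08-29, D671; director-bsd FOREST MOVE
HOME/INBOX.md l.234 after bench RESULT STATUS l.2877 «stub_layerL1Four needs three additional PUBLISHED hypotheses»).

WHAT CHANGED vs VARIANT M `Lines/coupled_variantM.lean` 406ca288e244d392 (which stays in the folder as the prior reading).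
VARIANT M's `stub_layerL1Four`, `stub_layerL1Seven`, `stub_thmC` were TRUE-by-print but NOT closable from the route's
inputs: the tree closes them from three DISPLAYED PRINT INPUTS — a degree-6 modular parametrisation `Dt` of `243b`
(HSY's `f : X₀(243) → E`), the NAMED height display #19 `HuShuYin2019.shaAnPair_mul_height_eq_two_zpow_mul_height_named`
(HSY 2019 Cor. 4.4 / display (bsd)), (ES2) #20 `Nekovar2007.cmPoint_frobeniusCongruence` (Nekovář 2007 Prop. 4.9) — plus,
on the `p ≡ 7 (mod 9)` class, the ONE research display (W2-b) «the level involution at `w ∣ 3` fixes the Heegner point of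
conductor `9pn`» (memo two §67.2; planner D552 node wording `∀ deg-6 Dt, hW2b`): tree theorems
`SylvesterTwoCMFlip.layerL1Four_of_named_of_flip` (p677294), `SylvesterTwoCMHalf.thmC_of_named_of_levelInvolutionFixing`,
`SylvesterTwoCMHalf.layerL1Seven_of_named_of_flip_of_levelInvolutionFixing` (`…CMHalfInvolutionFixingBottomOfLevel`).
HERE those three statements are CLOSED BY NAME inside the file (`layerL1Four_closed`, `thmC_closed`, `layerL1Seven_closed`,
VARIANT M's types VERBATIM) from TWO NEW STUBS: the PRINT stub `stub_printInputsTwo` (the three print inputs BY NAME —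
never a prover target; it closes by typing/acquiring print, cf. `stub_printInputsInert` of the K8 skeleton) and the
research stub `stub_levelFixingSeven` (= (W2-b), the `hW2b` binder of the two CMHalf theorems VERBATIM behind
`∀ Dt, Dt.deg = 6 →`).  `stub_tailFour`, `stub_tailSeven` are VARIANT M's VERBATIM (so k7t-c2 g28's
conditional tree theorems `SylvesterTwoCoupledTelescope.tailFour_of_residue` p714972 / `tailSeven_of_residue` p714989 conclude them
from {VII, RESIDUE c v3} unchanged, planner D665/D670); the composition `UpperOffV0HSYPlus_of` is VARIANT M's with the
closed theorems in place of the old stubs.  Registered stubs (FOUR): `stub_printInputsTwo` (print), `stub_levelFixingSeven`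
(research, row k-p1 / item 19802's (W2-b)), `stub_tailFour`, `stub_tailSeven` (row k-p2; RESIDUE c v3 leaves).
DEGENERATE-WITNESS / VACUITY PASS (planner D671): `stub_printInputsTwo`'s first conjunct is a genuine existence
(`ModularParametrizationData` carries the parametrisation; `deg = 6` is HSY's degree, used substantively by #19's
display); #19/#20 are Literature named facts (cite-tagged `def … : Prop`, unproved in the tree — debt of record);
`∃ Dt, Dt.deg = 6` is not junk-inhabitable (`c = 0` would make `φ` constant and violate `deg_spec`, `E(ℂ)` being
infinite; `f`, `uniformize` are pinned by `isNewformOf` / `uniformize_spec`, so a degree-6 `Dt` is HSY's `φ` up to the sign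
of the Manin constant); `stub_levelFixingSeven` quantifies over every degree-6 `Dt` (wording of record D552) and its fixing
clause is invariant under `φ ↦ −φ` (`pointGalHom _ _ _` is additive), its inner data (`ι, v ∣ 3, n, e, y, τ, φ`) are the
CMHalf theorems' binders already passed (D552/D590), and it is NOT implied by print (research).  VARIANT M's
DEGENERATE-MEMBER pass for the layer/tail types carries over verbatim.  Nothing is asserted; no stub is closed on the
ledger by this file; items 19802/19804 OPEN; X12.CMAtTwo NOT proved; BSD is not claimed for any curve. -/

set_option linter.dupNamespace false
set_option autoImplicit false

open scoped Classical Pointwise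
open WeierstrassCurve Field NumberField IsDedekindDomain IsDedekindDomain.HeightOneSpectrum
open Literature.NumberTheory.EllipticCurves Literature.NumberTheory.GaloisRepresentations
  Literature.NumberTheory.EllipticCurves.ModularForms
  Literature.NumberTheory.EllipticCurves.HuShuYin2019
  Literature.NumberTheory.EllipticCurves.KolyvaginCocycle
  Literature.NumberTheory.EllipticCurves.RingClassField

namespace Summit.BirchSwinnertonDyer.BirchSwinnertonDyer.Cruxes.UpperOffV0HSYPlus.CoupledVariantN

open Summit.BirchSwinnertonDyer.BirchSwinnertonDyer.Theses.SylvesterTwoHeegnerIndex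
open Summit.BirchSwinnertonDyer.BirchSwinnertonDyer.Theorems
open Summit.BirchSwinnertonDyer.BirchSwinnertonDyer.Theorems.SylvesterTwoCoupledUpperBound
open Summit.BirchSwinnertonDyer.BirchSwinnertonDyer.Theorems.SylvesterTwoFirstLayerSplit
open Summit.BirchSwinnertonDyer.BirchSwinnertonDyer.Theorems.SylvesterTwoCoupledDescentCebotarev
open Summit.BirchSwinnertonDyer.Rank1Residual.X11b Summit.BirchSwinnertonDyer.Rank1Residual.X11b.RingClassTower

/-- **PRINT stub — the three displayed print inputs of the LAYER/THEOREM-C side BY NAME** (never a prover target here;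
= the contents of planner ask #1 (ρ2′) `PublishedInputsKolyvaginTwo`): a degree-6 modular parametrisation of `243b`,
HSY's named height display #19, Nekovář's congruence (ES2) #20.
[cite: HuShuYin2019, Thm. 1.4, Cor. 4.4, display (bsd) p. 12] [cite: Nekovar2007, Prop. 4.9] -/
theorem stub_printInputsTwo :
    (∃ Dt : ModularParametrizationData (⟨0, 0, 1, 0, -1⟩ : WeierstrassCurve ℚ) 243, Dt.deg = 6) ∧
      shaAnPair_mul_height_eq_two_zpow_mul_height_named ∧ Nekovar2007.cmPoint_frobeniusCongruence := by
  sorry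

set_option maxHeartbeats 1600000 in
/-- **stub (research; row k-p1 / item 19802) — (W2-b) THE LEVEL INVOLUTION AT `w ∣ 3` FIXES THE HEEGNER POINT OF
CONDUCTOR `9pn`, `p ≡ 7 (mod 9)`** (the `hW2b` binder of `SylvesterTwoCMHalf.thmC_of_named_of_levelInvolutionFixing` /
`…layerL1Seven_of_named_of_flip_of_levelInvolutionFixing` VERBATIM, for every degree-6 `Dt`; memo two §67.2, desk
(M-K3-7); planner D552 node (ρ3)). [size M–L] [cite: GrossLMS1991, §3–§6] [cite: HuShuYin2019, §4.1 p. 10] -/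
theorem stub_levelFixingSeven :
    ∀ (Dt : ModularParametrizationData (⟨0, 0, 1, 0, -1⟩ : WeierstrassCurve ℚ) 243), Dt.deg = 6 →
      ∀ (p : ℕ), p.Prime → p % 9 = 7 → ∀ (K : Type) [Field K] [NumberField K] (ω : K), ω ^ 2 + ω + 1 = 0 →
      Module.finrank ℚ K = 2 → ∀ (ι : K →+* ℂ) (v : HeightOneSpectrum (𝓞 K)), ((3 : ℕ) : 𝓞 K) ∈ v.asIdeal →
      ∀ (n : ℕ), n ≠ 0 → (∀ q ∈ n.primeFactors, q % 3 = 2) →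
      ∀ (e : ringClassField K ι (9 * p * n) →+* AlgebraicClosure K),
      (∀ k : K, e (algebraMap K (ringClassField K ι (9 * p * n)) k) = algebraMap K (AlgebraicClosure K) k) →
      ∀ (y : ((⟨0, 0, 1, 0, -1⟩ : WeierstrassCurve ℚ).baseChange (ringClassField K ι (9 * p * n))).toAffine.Point),
      Affine.Point.map (W' := (⟨0, 0, 1, 0, -1⟩ : WeierstrassCurve ℚ)) (ringClassField K ι (9 * p * n)).subtype.toRatAlgHom y =
      Dt.φ (heegnerTau ((n : ℤ) ^ 2 * (81 * ((p : ℤ) ^ 2 + 4 * p + 16)),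
      (n : ℤ) * (-(9 * (4 * (p : ℤ) ^ 2 + 17 * p + 72))), 4 * (p : ℤ) ^ 2 + 18 * p + 81)) →
      ∀ (τ : absoluteGaloisGroup (v.adicCompletion K))
      (φ : ringClassField K ι (9 * p * n) ≃ₐ[K] ringClassField K ι (9 * p * n)),
      (∀ x : ringClassField K ι (9 * p * n), (show AlgebraicClosure K ≃ₐ[K] AlgebraicClosure K from
      resGal (K := K) (v.adicCompletion K) τ) (e x) = e (φ x)) → φ * φ = 1 →
      pointGalHom (⟨0, 0, 1, 0, -1⟩ : WeierstrassCurve ℚ) (ringClassField K ι (9 * p * n)) (φ.restrictScalars ℚ) y = y := by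
  sorry

set_option maxHeartbeats 1600000 in
/-- **CLOSED BY NAME — VARIANT M's `stub_layerL1Four` VERBATIM** from `stub_printInputsTwo` through
`SylvesterTwoCMFlip.layerL1Four_of_named_of_flip` (p677294). No `sorry` here. -/
theorem layerL1Four_closed : PublishedFactsTwoPlus →
      ∀ (p : ℕ), p.Prime → p % 9 = 4 → (¬ ∃ x : ZMod p, x ^ 3 = 3) →
        ∀ (A B : WeierstrassCurve ℚ) [A.IsElliptic] [A.IsGloballyMinimal] [B.IsElliptic]
          [B.IsGloballyMinimal], (∃ C : VariableChange ℚ, C • B = HuShuYin2019.cubeSumCurve (p : ℚ)) →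
          (∃ C : VariableChange ℚ, C • A = HuShuYin2019.cubeSumCurve (3 * (p : ℚ) ^ 2)) →
          ∀ (qB qA : ℚ), shaAn B = (qB : ℂ) → shaAn A = (qA : ℂ) → qB * qA ≠ 0 →
            padicValRat 2 (qB * qA) = 0 →
            ∀ (K : Type) [Field K] [NumberField K] (ω : K), ω ^ 2 + ω + 1 = 0 →
              Module.finrank ℚ K = 2 →
            ∀ Y₀ : ((cubeSumCurve (p : ℚ)).baseChange K).toAffine.Point,
              (¬ ∃ Q : ((cubeSumCurve (p : ℚ)).baseChange K).toAffine.Point, (2 : ℕ) • Q = Y₀) →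
            ∃ (cA : ℕ → galH1Torsion ((cubeSumCurve (3 * (p : ℚ) ^ 2)).baseChange K) (2 : ℕ))
              (cB : ℕ → galH1Torsion ((cubeSumCurve (p : ℚ)).baseChange K) (2 : ℕ)),
            (∀ ℓ, (ℓ.Prime ∧ ¬ ℓ ∣ (cubeSumCurve (3 * (p : ℚ) ^ 2)).conductorNorm ℤ ∧
                ¬ ℓ ∣ (cubeSumCurve (p : ℚ)).conductorNorm ℤ ∧ ¬ ((ℓ : ℤ) ∣ NumberField.discr K) ∧ ℓ ≠ 2 ∧
                (Ideal.span {(ℓ : 𝓞 K)}).IsPrime ∧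
                FrobEqFrobInfty (cubeSumCurve (3 * (p : ℚ) ^ 2)) K 2 ℓ ∧
                FrobEqFrobInfty (cubeSumCurve (p : ℚ)) K 2 ℓ) →
              (∀ v : HeightOneSpectrum (𝓞 K), (ℓ : 𝓞 K) ∉ v.asIdeal →
                cA ℓ ∈ selmerLocalKer ((cubeSumCurve (3 * (p : ℚ) ^ 2)).baseChange K)
                  (v.adicCompletion K) (2 : ℕ)) ∧
              (∀ x : InfinitePlace K, cA ℓ ∈ selmerLocalKer
                ((cubeSumCurve (3 * (p : ℚ) ^ 2)).baseChange K) x.Completion (2 : ℕ)) ∧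
              (∀ v : HeightOneSpectrum (𝓞 K), (ℓ : 𝓞 K) ∈ v.asIdeal →
                (cA ℓ ∈ selmerLocalKer ((cubeSumCurve (3 * (p : ℚ) ^ 2)).baseChange K)
                    (v.adicCompletion K) (2 : ℕ) ↔
                  kummerClassOfPoint (cubeSumCurve (p : ℚ)) K Nat.prime_two Y₀ ∈
                    ((cubeSumCurve (p : ℚ)).baseChange K).torsionLocalKer (v.adicCompletion K) (2 : ℕ)))) ∧
            (∀ ℓ ℓ', (ℓ.Prime ∧ ¬ ℓ ∣ (cubeSumCurve (3 * (p : ℚ) ^ 2)).conductorNorm ℤ ∧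
                ¬ ℓ ∣ (cubeSumCurve (p : ℚ)).conductorNorm ℤ ∧ ¬ ((ℓ : ℤ) ∣ NumberField.discr K) ∧ ℓ ≠ 2 ∧
                (Ideal.span {(ℓ : 𝓞 K)}).IsPrime ∧
                FrobEqFrobInfty (cubeSumCurve (3 * (p : ℚ) ^ 2)) K 2 ℓ ∧
                FrobEqFrobInfty (cubeSumCurve (p : ℚ)) K 2 ℓ) →
              (ℓ'.Prime ∧ ¬ ℓ' ∣ (cubeSumCurve (3 * (p : ℚ) ^ 2)).conductorNorm ℤ ∧
                ¬ ℓ' ∣ (cubeSumCurve (p : ℚ)).conductorNorm ℤ ∧ ¬ ((ℓ' : ℤ) ∣ NumberField.discr K) ∧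
                ℓ' ≠ 2 ∧ (Ideal.span {(ℓ' : 𝓞 K)}).IsPrime ∧
                FrobEqFrobInfty (cubeSumCurve (3 * (p : ℚ) ^ 2)) K 2 ℓ' ∧
                FrobEqFrobInfty (cubeSumCurve (p : ℚ)) K 2 ℓ') → ℓ ≠ ℓ' →
              (∀ v : HeightOneSpectrum (𝓞 K), (ℓ : 𝓞 K) ∉ v.asIdeal → (ℓ' : 𝓞 K) ∉ v.asIdeal →
                cB (ℓ * ℓ') ∈ selmerLocalKer ((cubeSumCurve (p : ℚ)).baseChange K)
                  (v.adicCompletion K) (2 : ℕ)) ∧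
              (∀ x : InfinitePlace K,
                cB (ℓ * ℓ') ∈ selmerLocalKer ((cubeSumCurve (p : ℚ)).baseChange K) x.Completion (2 : ℕ)) ∧
              (∀ v : HeightOneSpectrum (𝓞 K), (ℓ : 𝓞 K) ∈ v.asIdeal →
                (cB (ℓ * ℓ') ∈ selmerLocalKer ((cubeSumCurve (p : ℚ)).baseChange K)
                    (v.adicCompletion K) (2 : ℕ) ↔
                  cA ℓ' ∈ ((cubeSumCurve (3 * (p : ℚ) ^ 2)).baseChange K).torsionLocalKer
                    (v.adicCompletion K) (2 : ℕ)))) := by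
  obtain ⟨⟨Dt, hdeg⟩, hD, hES2⟩ := stub_printInputsTwo
  exact SylvesterTwoCMFlip.layerL1Four_of_named_of_flip Dt hdeg hD hES2

set_option maxHeartbeats 1600000 in
/-- **CLOSED BY NAME — VARIANT M's `stub_thmC` VERBATIM** (THEOREM C, item 19802) from `stub_printInputsTwo` +
`stub_levelFixingSeven` through `SylvesterTwoCMHalf.thmC_of_named_of_levelInvolutionFixing`. No `sorry` here. -/
theorem thmC_closed : PublishedFactsTwoPlus → SylvesterTwoNonneg.HSYPointTwoDivisibleSevenModNine := by
  obtain ⟨⟨Dt, hdeg⟩, hD, -⟩ := stub_printInputsTwo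
  exact SylvesterTwoCMHalf.thmC_of_named_of_levelInvolutionFixing Dt hdeg hD (stub_levelFixingSeven Dt hdeg)

set_option maxHeartbeats 1600000 in
/-- **CLOSED BY NAME — VARIANT M's `stub_layerL1Seven` VERBATIM** from `stub_printInputsTwo` + `stub_levelFixingSeven`
through `SylvesterTwoCMHalf.layerL1Seven_of_named_of_flip_of_levelInvolutionFixing`. No `sorry` here. -/
theorem layerL1Seven_closed : SylvesterTwoNonneg.HSYPointTwoDivisibleSevenModNine →
    (PublishedFactsTwoPlus →
      ∀ (p : ℕ), p.Prime → p % 9 = 7 → (¬ ∃ x : ZMod p, x ^ 3 = 3) →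
        ∀ (A B : WeierstrassCurve ℚ) [A.IsElliptic] [A.IsGloballyMinimal] [B.IsElliptic]
          [B.IsGloballyMinimal], (∃ C : VariableChange ℚ, C • B = HuShuYin2019.cubeSumCurve (p : ℚ)) →
          (∃ C : VariableChange ℚ, C • A = HuShuYin2019.cubeSumCurve (3 * (p : ℚ) ^ 2)) →
          ∀ (qB qA : ℚ), shaAn B = (qB : ℂ) → shaAn A = (qA : ℂ) → qB * qA ≠ 0 →
            padicValRat 2 (qB * qA) = 0 →
            ∀ (K : Type) [Field K] [NumberField K] (ω : K), ω ^ 2 + ω + 1 = 0 →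
              Module.finrank ℚ K = 2 →
            ∀ Y₀ : ((cubeSumCurve (p : ℚ)).baseChange K).toAffine.Point,
              (¬ ∃ Q : ((cubeSumCurve (p : ℚ)).baseChange K).toAffine.Point, (2 : ℕ) • Q = Y₀) →
            ∃ (cA : ℕ → galH1Torsion ((cubeSumCurve (3 * (p : ℚ) ^ 2)).baseChange K) (2 : ℕ))
              (cB : ℕ → galH1Torsion ((cubeSumCurve (p : ℚ)).baseChange K) (2 : ℕ)),
            (∀ ℓ, (ℓ.Prime ∧ ¬ ℓ ∣ (cubeSumCurve (3 * (p : ℚ) ^ 2)).conductorNorm ℤ ∧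
                ¬ ℓ ∣ (cubeSumCurve (p : ℚ)).conductorNorm ℤ ∧ ¬ ((ℓ : ℤ) ∣ NumberField.discr K) ∧ ℓ ≠ 2 ∧
                (Ideal.span {(ℓ : 𝓞 K)}).IsPrime ∧
                FrobEqFrobInfty (cubeSumCurve (3 * (p : ℚ) ^ 2)) K 2 ℓ ∧
                FrobEqFrobInfty (cubeSumCurve (p : ℚ)) K 2 ℓ) →
              (∀ v : HeightOneSpectrum (𝓞 K), (ℓ : 𝓞 K) ∉ v.asIdeal →
                cA ℓ ∈ selmerLocalKer ((cubeSumCurve (3 * (p : ℚ) ^ 2)).baseChange K)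
                  (v.adicCompletion K) (2 : ℕ)) ∧
              (∀ x : InfinitePlace K, cA ℓ ∈ selmerLocalKer
                ((cubeSumCurve (3 * (p : ℚ) ^ 2)).baseChange K) x.Completion (2 : ℕ)) ∧
              (∀ v : HeightOneSpectrum (𝓞 K), (ℓ : 𝓞 K) ∈ v.asIdeal →
                (cA ℓ ∈ selmerLocalKer ((cubeSumCurve (3 * (p : ℚ) ^ 2)).baseChange K)
                    (v.adicCompletion K) (2 : ℕ) ↔
                  kummerClassOfPoint (cubeSumCurve (p : ℚ)) K Nat.prime_two Y₀ ∈
                    ((cubeSumCurve (p : ℚ)).baseChange K).torsionLocalKer (v.adicCompletion K) (2 : ℕ)))) ∧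
            (∀ ℓ ℓ', (ℓ.Prime ∧ ¬ ℓ ∣ (cubeSumCurve (3 * (p : ℚ) ^ 2)).conductorNorm ℤ ∧
                ¬ ℓ ∣ (cubeSumCurve (p : ℚ)).conductorNorm ℤ ∧ ¬ ((ℓ : ℤ) ∣ NumberField.discr K) ∧ ℓ ≠ 2 ∧
                (Ideal.span {(ℓ : 𝓞 K)}).IsPrime ∧
                FrobEqFrobInfty (cubeSumCurve (3 * (p : ℚ) ^ 2)) K 2 ℓ ∧
                FrobEqFrobInfty (cubeSumCurve (p : ℚ)) K 2 ℓ) →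
              (ℓ'.Prime ∧ ¬ ℓ' ∣ (cubeSumCurve (3 * (p : ℚ) ^ 2)).conductorNorm ℤ ∧
                ¬ ℓ' ∣ (cubeSumCurve (p : ℚ)).conductorNorm ℤ ∧ ¬ ((ℓ' : ℤ) ∣ NumberField.discr K) ∧
                ℓ' ≠ 2 ∧ (Ideal.span {(ℓ' : 𝓞 K)}).IsPrime ∧
                FrobEqFrobInfty (cubeSumCurve (3 * (p : ℚ) ^ 2)) K 2 ℓ' ∧
                FrobEqFrobInfty (cubeSumCurve (p : ℚ)) K 2 ℓ') → ℓ ≠ ℓ' →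
              (∀ v : HeightOneSpectrum (𝓞 K), (ℓ : 𝓞 K) ∉ v.asIdeal → (ℓ' : 𝓞 K) ∉ v.asIdeal →
                cB (ℓ * ℓ') ∈ selmerLocalKer ((cubeSumCurve (p : ℚ)).baseChange K)
                  (v.adicCompletion K) (2 : ℕ)) ∧
              (∀ x : InfinitePlace K,
                cB (ℓ * ℓ') ∈ selmerLocalKer ((cubeSumCurve (p : ℚ)).baseChange K) x.Completion (2 : ℕ)) ∧
              (∀ v : HeightOneSpectrum (𝓞 K), (ℓ : 𝓞 K) ∈ v.asIdeal →
                (cB (ℓ * ℓ') ∈ selmerLocalKer ((cubeSumCurve (p : ℚ)).baseChange K)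
                    (v.adicCompletion K) (2 : ℕ) ↔
                  cA ℓ' ∈ ((cubeSumCurve (3 * (p : ℚ) ^ 2)).baseChange K).torsionLocalKer
                    (v.adicCompletion K) (2 : ℕ))))) := by
  obtain ⟨⟨Dt, hdeg⟩, hD, hES2⟩ := stub_printInputsTwo
  exact SylvesterTwoCMHalf.layerL1Seven_of_named_of_flip_of_levelInvolutionFixing Dt hdeg hD hES2
    (stub_levelFixingSeven Dt hdeg)

set_option maxHeartbeats 1600000 in
/-- **CLOSED — FIRST LAYER, p ≡ 4 (9)** (VARIANT M's `firstLayerFour_closed` VERBATIM, from `layerL1Four_closed` by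
g22 #22 `firstLayerFour_of_layerL1`). -/
theorem firstLayerFour_closed : PublishedFactsTwoPlus →
    ∀ (p : ℕ), p.Prime → p % 9 = 4 → (¬ ∃ x : ZMod p, x ^ 3 = 3) →
      ∀ (A B : WeierstrassCurve ℚ) [A.IsElliptic] [A.IsGloballyMinimal] [B.IsElliptic]
        [B.IsGloballyMinimal], (∃ C : VariableChange ℚ, C • B = HuShuYin2019.cubeSumCurve (p : ℚ)) →
        (∃ C : VariableChange ℚ, C • A = HuShuYin2019.cubeSumCurve (3 * (p : ℚ) ^ 2)) →
        ∀ (qB qA : ℚ), shaAn B = (qB : ℂ) → shaAn A = (qA : ℂ) → qB * qA ≠ 0 →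
          padicValRat 2 (qB * qA) = 0 →
          Nat.card (AddCommGroup.primaryComponent B.sha 2) = 1 ∧
            Nat.card (AddCommGroup.primaryComponent A.sha 2) = 1 :=
  firstLayerFour_of_layerL1 layerL1Four_closed

/-- **stub (row k-p2, p ≡ 4 (9)) — TAIL** (VARIANT M's VERBATIM; CONDITIONAL tree theorem
`SylvesterTwoCoupledTelescope.tailFour_of_residue hvii H3_holds LP_holds hR`, p714972/p715484: ⟸ {VII, RESIDUE 4 v3}).
[size L–XL] -/
theorem stub_tailFour : PublishedFactsTwoPlus →
    ∀ (p : ℕ), p.Prime → p % 9 = 4 → (¬ ∃ x : ZMod p, x ^ 3 = 3) →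
      ∀ (A B : WeierstrassCurve ℚ) [A.IsElliptic] [A.IsGloballyMinimal] [B.IsElliptic]
        [B.IsGloballyMinimal], (∃ C : VariableChange ℚ, C • B = HuShuYin2019.cubeSumCurve (p : ℚ)) →
        (∃ C : VariableChange ℚ, C • A = HuShuYin2019.cubeSumCurve (3 * (p : ℚ) ^ 2)) →
        4 < Nat.card (AddCommGroup.primaryComponent B.sha 2) *
            Nat.card (AddCommGroup.primaryComponent A.sha 2) →
        ∃ qB qA : ℚ, shaAn B = (qB : ℂ) ∧ shaAn A = (qA : ℂ) ∧ qB * qA ≠ 0 ∧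
          (padicValNat 2 (Nat.card (AddCommGroup.primaryComponent B.sha 2)) : ℤ) +
              (padicValNat 2 (Nat.card (AddCommGroup.primaryComponent A.sha 2)) : ℤ) ≤
            padicValRat 2 (qB * qA) := by
  sorry

set_option maxHeartbeats 1600000 in
/-- **CLOSED — FIRST LAYER, p ≡ 7 (9)** (VARIANT M's `firstLayerSeven_closed` VERBATIM, from `thmC_closed` +
`layerL1Seven_closed` by g22 #22 `firstLayerSeven_of_layerL1`). -/
theorem firstLayerSeven_closed : PublishedFactsTwoPlus →
    ∀ (p : ℕ), p.Prime → p % 9 = 7 → (¬ ∃ x : ZMod p, x ^ 3 = 3) →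
      ∀ (A B : WeierstrassCurve ℚ) [A.IsElliptic] [A.IsGloballyMinimal] [B.IsElliptic]
        [B.IsGloballyMinimal], (∃ C : VariableChange ℚ, C • B = HuShuYin2019.cubeSumCurve (p : ℚ)) →
        (∃ C : VariableChange ℚ, C • A = HuShuYin2019.cubeSumCurve (3 * (p : ℚ) ^ 2)) →
        ∀ (qB qA : ℚ), shaAn B = (qB : ℂ) → shaAn A = (qA : ℂ) → qB * qA ≠ 0 →
          padicValRat 2 (qB * qA) = 0 →
          Nat.card (AddCommGroup.primaryComponent B.sha 2) = 1 ∧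
            Nat.card (AddCommGroup.primaryComponent A.sha 2) = 1 :=
  fun hF ↦ firstLayerSeven_of_layerL1 (layerL1Seven_closed (thmC_closed hF)) hF

/-- **stub (row k-p2, p ≡ 7 (9)) — TAIL** (VARIANT M's VERBATIM; CONDITIONAL tree theorem
`SylvesterTwoCoupledTelescope.tailSeven_of_residue …`, p714989/p715484: ⟸ {VII, RESIDUE 7 v3}). [size L–XL] -/
theorem stub_tailSeven : PublishedFactsTwoPlus →
    ∀ (p : ℕ), p.Prime → p % 9 = 7 → (¬ ∃ x : ZMod p, x ^ 3 = 3) →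
      ∀ (A B : WeierstrassCurve ℚ) [A.IsElliptic] [A.IsGloballyMinimal] [B.IsElliptic]
        [B.IsGloballyMinimal], (∃ C : VariableChange ℚ, C • B = HuShuYin2019.cubeSumCurve (p : ℚ)) →
        (∃ C : VariableChange ℚ, C • A = HuShuYin2019.cubeSumCurve (3 * (p : ℚ) ^ 2)) →
        4 < Nat.card (AddCommGroup.primaryComponent B.sha 2) *
            Nat.card (AddCommGroup.primaryComponent A.sha 2) →
        ∃ qB qA : ℚ, shaAn B = (qB : ℂ) ∧ shaAn A = (qA : ℂ) ∧ qB * qA ≠ 0 ∧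
          (padicValNat 2 (Nat.card (AddCommGroup.primaryComponent B.sha 2)) : ℤ) +
              (padicValNat 2 (Nat.card (AddCommGroup.primaryComponent A.sha 2)) : ℤ) ≤
            padicValRat 2 (qB * qA) := by
  sorry

/-- **Composition (kernel-checked)**: the crux BY NAME — VARIANT M's composition with the closed theorems in place
of the old layer/thmC stubs (p590593 `coupledUpperBoundFour_of_firstLayer_of_tail` /
`coupledUpperBoundSeven_of_thmC_of_firstLayer_of_tail`, K3R-7 `upperOffV0HSYPlus_of_coupledUpperBounds`). -/
theorem UpperOffV0HSYPlus_of :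
    Summit.BirchSwinnertonDyer.BirchSwinnertonDyer.Theses.SylvesterTwoHeegnerIndex.UpperOffV0HSYPlus :=
  fun hF =>
    upperOffV0HSYPlus_of_coupledUpperBounds
      (coupledUpperBoundFour_of_firstLayer_of_tail hF (firstLayerFour_closed hF) (stub_tailFour hF))
      (coupledUpperBoundSeven_of_thmC_of_firstLayer_of_tail hF (firstLayerSeven_closed hF) (stub_tailSeven hF)
        (thmC_closed hF)) hF

end Summit.BirchSwinnertonDyer.BirchSwinnertonDyer.Cruxes.UpperOffV0HSYPlus.CoupledVariantN
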